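import Summits.CriticalPhenomena.PercolationContinuityZ3.Theorems.PercNearOneGluingNoHeavyRsw3InvasionUniqueCluster
import HarnessLib

/-!
# RSW3 lane (P2, gen 26): INVASION PERCOLATION IX — outlets: whenever a label `> y` is accepted, the invaded region is a union of
# COMPLETE `y`-clusters; on `ℤ^d` (`d ≥ 2`, p205010) this happens at level `y = p_c` infinitely often

builds on p205010 (kernel theorem, internal audit signed; external expert review pending) — used (through file V) only in the `ℤ^d`
statements at level `p_c`.

Cell `prim-rsw3`, prover seat `prim-rsw3-p2` (gen 26), memo `run/shared/lean/prim/rsw3/P2-RSWLITE.md` §33.  Support file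
(`--supports stmt-CriticalPhenomena-4575`); no definitions, no named facts, no sorries.

The "ponds and outlets" skeleton of invasion percolation (the steps at which a bond of label `> p_c` — an OUTLET — is accepted;
cf. Damron–Sapozhnikov–Vágvölgyi for `d = 2`), in the generality of file VI's cluster-absorption priority:

* **`coe_invasion_eq_biUnion_openCluster_of_lt_acceptedLabel`** (every locally finite graph, every label field, every `y`): if the label
  accepted at step `n` is `> y`, then `I_n = ⋃_{u ∈ I_n} C_y(u)` — the invaded region is a union of COMPLETE `y`-open clusters (each
  finite); in particular `C_y(o) ⊆ I_n`.
* `acceptedLabel_le_of_exists_not_mem` — contrapositive: if some `y`-cluster of an invaded vertex sticks out of `I_n`, then `x_n ≤ y`.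
* **`ae_frequently_invasion_eq_biUnion_criticalCluster`** (`ℤ^d`, `d ≥ 2`): almost surely, for infinitely many `n`, the invaded region
  `I_n` is exactly a finite union of complete critical (`p_c`-) clusters — the outlet times are a.s. unbounded (file V) and at each of
  them the pond structure closes up.
* `ae_frequently_criticalCluster_root_subset_invasion` (`d ≥ 2`): in particular the whole critical cluster of the origin is invaded
  (a.s., at every outlet time; it is finite by p205010).

References: J. T. Chayes, L. Chayes, C. M. Newman, Comm. Math. Phys. 101 (1985) §3 (ii) [ChayesChayesNewman1985]; M. Damron, A. Sapozhnikov,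
B. Vágvölgyi, *Relations between invasion percolation and critical percolation in two dimensions*, Ann. Probab. 37 (2009) (ponds and outlets).
-/

noncomputable section

namespace Summit.CriticalPhenomena.PercolationContinuityZ3.Theorems.Rsw3

open Finset MeasureTheory Filter Topology Literature.Probability.LatticeModels Literature.Probability.Percolation
open Literature.Probability.Percolation.Invasion

/-! ## §1 Outlet steps close the ponds (every graph) -/

section General

variable {V : Type*} [DecidableEq V] {G : SimpleGraph V} [G.LocallyFinite]

/-- If some `y`-open cluster of an invaded vertex is not yet entirely invaded, the accepted label is `≤ y` (file VI's priority lemma,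
existential form). [cite: ChayesChayesNewman1985, §3 (ii)] -/
theorem acceptedLabel_le_of_exists_not_mem {U : Sym2 V → ℝ} {o : V} {n : ℕ} {y : ℝ}
    (h : ∃ u ∈ invasion G U o n, ∃ v ∈ openCluster (configOfLabels y U G) u, v ∉ invasion G U o n) :
    acceptedLabel G U o n ≤ y := by
  obtain ⟨u, hu, v, hv, hvI⟩ := h
  exact acceptedLabel_le_of_openCluster_not_subset hu fun hsub => hvI (Finset.mem_coe.1 (hsub hv))

/-- **At an outlet step the invaded region is a union of complete `y`-clusters**: if `x_n > y` then `I_n = ⋃_{u ∈ I_n} C_y(u)`.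
[cite: ChayesChayesNewman1985, §3 (ii) (clusters are absorbed whole before the next unoccupied bond)] -/
theorem coe_invasion_eq_biUnion_openCluster_of_lt_acceptedLabel {U : Sym2 V → ℝ} {o : V} {n : ℕ} {y : ℝ}
    (hn : y < acceptedLabel G U o n) :
    (↑(invasion G U o n) : Set V) = ⋃ u ∈ invasion G U o n, openCluster (configOfLabels y U G) u := by
  apply Set.Subset.antisymm
  · intro u hu
    exact Set.mem_biUnion hu (mem_openCluster_self _ u)
  · intro v hv
    obtain ⟨u, hu, hvu⟩ := Set.mem_iUnion₂.1 hv
    by_contra hvI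
    exact absurd (acceptedLabel_le_of_exists_not_mem ⟨u, Finset.mem_coe.1 hu, v, hvu, fun h => hvI (Finset.mem_coe.2 h)⟩)
      (not_le.2 hn)

/-- At an outlet step the whole `y`-cluster of the root has been invaded. [cite: ChayesChayesNewman1985, §3 (ii)] -/
theorem openCluster_root_subset_invasion_of_lt_acceptedLabel {U : Sym2 V → ℝ} {o : V} {n : ℕ} {y : ℝ}
    (hn : y < acceptedLabel G U o n) :
    openCluster (configOfLabels y U G) o ⊆ ↑(invasion G U o n) := by
  rw [coe_invasion_eq_biUnion_openCluster_of_lt_acceptedLabel hn]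
  exact Set.subset_biUnion_of_mem (u := fun u => openCluster (configOfLabels y U G) u)
    (Finset.mem_coe.2 (root_mem_invasion U o n))

end General

/-! ## §2 `ℤ^d`: the critical ponds close up infinitely often -/

variable {d : ℕ}

/-- **On `ℤ^d` (`d ≥ 2`), almost surely, for infinitely many `n` the invaded region `I_n` is EXACTLY a union of complete critical
clusters** (`p_c`-clusters of its own vertices, all finite): the outlet times — steps with `x_n > p_c` — are unbounded (file V, p205010)
and at each of them the ponds close up. [cite: ChayesChayesNewman1985, §3 (ii) and Thm 3.2 (discussion)] -/
theorem ae_frequently_invasion_eq_biUnion_criticalCluster (hd : 2 ≤ d) :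
    ∀ᵐ U ∂(labelMeasure (Site d)), ∃ᶠ n in atTop,
      (↑(invasion (zdGraph d) U 0 n) : Set (Site d)) =
        ⋃ u ∈ invasion (zdGraph d) U 0 n, openCluster (configOfLabels (criticalProbI d : ℝ) U (zdGraph d)) u := by
  filter_upwards [ae_frequently_criticalProb_lt_acceptedLabel hd] with U hU
  exact hU.mono fun n hn => coe_invasion_eq_biUnion_openCluster_of_lt_acceptedLabel hn

/-- **On `ℤ^d` (`d ≥ 2`), almost surely the whole critical cluster of the origin is eventually invaded** — indeed `C_{p_c}(0) ⊆ I_n` at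
every outlet time `n`, and there are infinitely many. [cite: ChayesChayesNewman1985, §3 (ii)] -/
theorem ae_frequently_criticalCluster_root_subset_invasion (hd : 2 ≤ d) :
    ∀ᵐ U ∂(labelMeasure (Site d)), ∃ᶠ n in atTop,
      openCluster (configOfLabels (criticalProbI d : ℝ) U (zdGraph d)) 0 ⊆ ↑(invasion (zdGraph d) U 0 n) := by
  filter_upwards [ae_frequently_criticalProb_lt_acceptedLabel hd] with U hU
  exact hU.mono fun n hn => openCluster_root_subset_invasion_of_lt_acceptedLabel hn

/-- Consequently the critical cluster of the origin lies inside the invaded region, almost surely (`d ≥ 2`).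
[cite: ChayesChayesNewman1985, §3 (ii)] -/
theorem ae_criticalCluster_root_subset_invadedRegion (hd : 2 ≤ d) :
    ∀ᵐ U ∂(labelMeasure (Site d)),
      openCluster (configOfLabels (criticalProbI d : ℝ) U (zdGraph d)) 0 ⊆ invadedRegion (zdGraph d) U 0 := by
  filter_upwards [ae_frequently_criticalCluster_root_subset_invasion hd] with U hU
  obtain ⟨n, hn⟩ := hU.exists
  exact fun x hx => (mem_invadedRegion _).2 ⟨n, Finset.mem_coe.1 (hn hx)⟩

end Summit.CriticalPhenomena.PercolationContinuityZ3.Theorems.Rsw3
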